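import Summits.RiemannHypothesis.RiemannHypothesis.Theorems.GroundBartaEvenWinsBeyondArchPhantomXT120Data12
import HarnessLib

/-!
# RiemannHypothesis / GroundBarta machinery — phantom chain XT120: kernel check of data chunk 12

Helper DATA file (`--supports stmt-RiemannHypothesis-18085 --as helper`), RH-free.  Seat rh-explicit-weil-1.  Part of the T = 120 lattice-ripple (phantom) chain `xt120Cells` for the separable 12-harmonic phantom `rsOfSep xt120Ph2 xt120Ph3` (θ₂-harmonics j = 3..8, θ₃-harmonics k = 2..7; LP/Fejér–Riesz data of kit j143029): Taylor-sum cells `XTCell` of width 1/2, order n = 24, two-sided engine claims with margin 2e-8, generated by `gen/phantomgen.py` (exact mirror of the checker; nothing about the data is trusted — only kernel-evaluated Booleans are consumed).  With the boosted tail level wL = 269/100 (`xt120Level`: ∀ |t| ≥ 120, 269/100 ≤ w₂₃(t) + P(t)) this chain turns the LANDED two-prime T120 chain (level ≈ 1.8455 pointwise-amplitude, 2.09 sharp) into a level-269/100 chain for the phantom certificate format `WeilCert23X` (…PhantomCertificate*.lean; memo rh-explicit-weil-1/FORMAT-PHANTOM.md).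
-/

set_option linter.dupNamespace false

noncomputable section

namespace Summit.RiemannHypothesis.RiemannHypothesis.Theorems.EvenWinsBeyondArch

open Literature.NumberTheory.LFunctions

/-- Every cell of chunk 12 passes the integer checker `XTCell.checkZ` (kernel evaluation). [folklore] -/
theorem checkZ_xt120Cells12 : (xt120Cells12.all XTCell.checkZ) = true := by
  decide +kernel

end Summit.RiemannHypothesis.RiemannHypothesis.Theorems.EvenWinsBeyondArch

end
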